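import Literature.MathematicalPhysics.QuantumFieldTheory.BalabanImbrieJaffe1984to88.BIJ88Eq596Passage
import Literature.MathematicalPhysics.QuantumFieldTheory.BalabanImbrieJaffe1984to88.BIJ88RT54ScalarSubst
import Literature.MathematicalPhysics.QuantumFieldTheory.BalabanImbrieJaffe1984to88.BIJ88RT552Transl

/-!
# `BalabanImbrieJaffe1984to88.BIJ88Eq596Frame` — T. Bałaban, J. Imbrie, A. Jaffe, *Effective action and cluster properties of the
abelian Higgs model*, Commun. Math. Phys. **114** (1988) 257–315 [BalabanImbrieJaffe1988], **(5.9.6)** p. 297 [PDF 41]: *"Let us summarize the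
operations performed so far by using the concluding formulae in the last several sections to write a complete expression for our density.
ρ^L_{k+1}(v, ψ) = Σ_{{X_ω}} Σ_{Λ₀^{(k)}} ∫du^{(k)}dφ^{(k)} δ_{Ax}(u^{(k)}) δ_{Λ₁^{(k)′*c}}(v/Qu^{(k)}) δ_{Λ₁^{(k)′*}}((e_k/2π)QA^{(k)}) ∫Π_{j=0}^{k−1}du^{(j)}|_{Λ₁₀^{(j)c*}
× ζ_{Λ₀^{(k)c}}χ_{Λ₀^{(k)}}χ_{k,Λ₀^{(k−1)′}∩Λ₁^{(k)c}}χ_{k+1,Λ₀^{(k)′}}χ′_{Λ₇^{(k)}} Π_ω g_k(X_ω) Π_σ (F^{(m̄)}_{k,loc}(X_σ) + F̃^{(k)}_{loc}(X_σ)) × Π_{j=0}^{k−1}[Z^{(j)}_{Λ₁₀^{(j)c*c}}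
Z^{(j)}_{Λ₁₀^{(j)}}(u_{k+1})] exp[−½⟨Λ₁^{(k)**}∂A^{(k)}, σ_{k,loc}Λ₁^{(k)**}∂A^{(k)}⟩ −½⟨Λ₅^{(k)′**}f, σ^L_{k+1,loc}Λ₅^{(k)′**}f⟩ − 𝒬₁ − 𝒬₂ − 𝒬₃ − ⟨f, w₃A^{(k)}⟩
− ½⟨f, w₄f⟩ − 𝒬₄ − 𝒬₅ − 𝒬₆ − ½⟨Λ₈^{(k−1)′}φ^{(k)}, (Δ_{k,loc}(ũ_{k+1}) + aL⁻²P(ũ_{k+1}))Λ₈^{(k−1)′}φ^{(k)}⟩ − ½⟨Λ₈^{(k)′}ψ, Δ^L_{k+1,loc}(u_{k+1})Λ₈^{(k)′}ψ⟩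
− ⟨φ^{(k)}, w₆ψ⟩ − ½⟨ψ, w₇ψ⟩ − ℰ_k − E^{(k)} − 𝒫_{k,loc}(Λ₈^{(k−1)}, ũ_{k+1}) − R^{(k)}(u_{k+1}, θ_kH_{k,loc}A^{(k)}) − Σ_□ W₁^{(k)}(□) − Q^{(k)}(u_{k+1},
θ_kH_{k,loc}A^{(k)}) − Σ_X W₂^{(k)}(X)]. (5.9.6)"* — **THE DISPLAY (5.9.6) AS A THEOREM AT MEASURE LEVEL: THE COMPOSITION OF THE OPERATIONS OF
SECTS. 5.3–5.9 ON THE DENSITY.**  Starting from the density display (5.2.8) (*"Our density now has the form (5.2.8)"*, gen 8's `IsRD` over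
`∫𝒟u δ_{Ax}(u)(·)` with the printed `Q` — PROVIDED for the printed characteristic functions by gen 8's `BIJ88Eq528Density.density528`), the
operations that act on the integration variables or on the density itself — (5.3.1)/(5.3.6) the first gauge field translation with cut-off
`Λ₁^{(k)′*}` (file `BIJ88Eq596Passage`), p. 282 the rotation `φ ↦ φ′` and the renaming `ψ′ → ψ` (*"a different density is obtained"*, file
`BIJ88RT54ScalarSubst`; the new density exists for every integrable bracket: this seat's `BIJ88Eq596Exists.rdt`), (5.5.2) the second gauge field translation with the p. 284 δ-claims (file
`BIJ88RT552Transl`), (5.8.1) the scalar field translation (file `BIJ88RT54ScalarSubst`) — are composed, the *"concluding formulae in the last several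
sections"* that rewrite the BRACKET pointwise ((5.4.3)–(5.4.10) the background gauge transformation and its kernels, (5.5.3)–(5.5.14), (5.6.6)–(5.6.13),
(5.7.13), (5.8.2)–(5.8.3), and the insertions of characteristic functions of Sect. 5.9 *"without changing anything"*) entering as two pointwise
hypotheses on the brackets (`h54`: after (5.3.6) the bracket is a function of the rotated scalar fields; `h59`: the printed bracket of (5.9.6) is the
renamed bracket read in the shifted and translated variables).  CONCLUSION (`eq596_frame`): THE RENAMED DENSITY `ρ^L_{k+1}` (ANY solution of line 1 of (5.9.6) with the renamed bracket)
SATISFIES LINE 1 OF (5.9.6) WITH THE PRINTED BRACKET — `IsDT (𝒟u δ_{Ax}) terms Λ₁′* Q J₅₉₆ ρ^L_{k+1}` — AND `∫dvdψ ρ^L_{k+1} = ∫dvdψ ρ̃^L_{k+1}` (*"still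
has the property that ∫dvdψ ρ^L_{k+1}(v, ψ) = [F]"*: the right side is `[F]` by gens 5–8, `BIJ88RT51NoChange.bracket_eq_integral_of_isRT511`).
Seat p34 gen 9, file 5 (own lineage = the C1/C2 renormalization-transformation line).

statement-level skeleton of published theorems with citation tags; proofs where landed; nothing here is a claim about the Yang–Mills mass gap

PDF held: `paper:balaban1988-cmp114-bij-abelian-higgs-effective-action` (journal page = PDF page + 256); p. 297 [PDF 41] re-read this session as an
image (r16's render `HOME/lit-balaban-r16/renders/cmp114/original-p041-x2.png`; the display above is transcribed from it), pp. 280–284, 295.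
CITATION HEADER (lean-in-tree rule).  Part of the lit-balaban TYPED SKELETON (HOME `run/shared/lean/pub/lit-balaban/`), PHASE-2 proof seat p34
gen 9 (unit `lit-balaban-p34-g9`; TAKING line HOME/STATUS.md 2026-08-21T21:12:57Z).  Row served: **`C2.Eq5.9.6`** of `HOME/lit-balaban-r16/ROWS-C2-part2.md`
(owner r16: *"a single density596-style theorem/def carrying the full printed display is what flips absent"*; this file gives the display's
MEASURE-LEVEL form with the bracket abstract — the 30 printed symbols of the bracket are the typed carriers of rows C2.Eq5.4.x–5.8.x (r16,
p02, p31, p36) and enter through `h59`); support `C2.Eq5.4.1-5.4.6`, `C2.Eq5.5.1-5.5.12`, `C2.Eq5.8.1-5.8.3`.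

THE READING (declared).  `terms` = the pairs `({X_ω}, Λ₀^{(k)})`; `Λ t` = `Λ₁^{(k)′*}` of the term; `ν = 𝒟u δ_{Ax}` (r18's `axialMeasure`); `Q` = r18's
`qU`; the (5.2.8) data `(ρ_t, Q_t = Q(u_k)φ, a)` with `ψ`-dependent `ρ_t` (the inserted `χ_y` see `ψ`); `lamφ`, `lamψ` = the p. 282 phases
`e^{ie_k(Λ̄₃^{(k)}C_{k,loc}A′)}` on the two lattices as functions of `({u^{(j)}}, u′, v)`; `J₂` = the bracket as a function of `(φ′, ψ′)`; `s_t` = the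
(5.5.2) shift `e^{−ie_kΛ₄^{(k)*}L⁻²C^{(k)}_{loc}H*_{k,loc}∂*Q^{e*}_{k+1}f}` as a function of `v|_{Λ_t}`, trivial on the axial tree bonds, with its
small-field sets `S_t`; `c_t` = the (5.8.1) shift `aL⁻²Λ₇^{(k)}C^{(k)}_{loc}(u_{k+1})Q*(u_{k+1})ψ` as a function of `({u^{(j)}}, u^{(k)}, v, ψ)`; `J596` =
the printed bracket (lines 2–8 of (5.9.6)).

WHAT IS PROVED (theorems; §2 a structure and three defs with bodies — the transcribed bracket; 0 `sorry`; no `Prop`-valued fact; standard axioms):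
`isDT_after536` ((5.2.8) ⇒ line 1 with the (5.3.6) bracket), `isDT_after_rotation` (p. 282 rotation), `integral_renamed_eq` (a renamed density `ρ₂` —
any solution of the display with `J₂` — has the same `∫dvdψ`), `integral_renamed_eq_of_invariant` (same integrals against ψ-rotation-invariant tests), **`eq596_frame`**
(the composition through (5.5.2), (5.8.1) and the rewritings: `IsDT ν terms Λ Q J596 ρ^L_{k+1}`), `eq596_unique` (any integrable solution is `ρ^L_{k+1}`
a.e.); §2 the printed bracket TRANSCRIBED (`Bracket596` = the 25 printed entries of lines 2–8 as typed slots, `exponent596`, `bracket596`) and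
`eq596_frame_printed` (= `eq596_frame` with `J596 := bracket596 D`).  READING TABLE (owner r16's criterion, INBOX 21:21Z): §2 `Bracket596` has ONE FIELD PER
PRINTED FACTOR of lines 2–8, each field's docstring = the printed symbol + the equation that constructs it (`chars` = `ζ_{Λ₀^{(k)c}}χ_{Λ₀^{(k)}}χ_{k,…}χ_{k+1,Λ₀^{(k)′}}χ′_{Λ₇^{(k)}}`,
`holes` = `Π_ω g_k(X_ω)`, `obs` = `Π_σ(F^{(m̄)}_{k,loc} + F̃^{(k)}_{loc})`, `zf` = `Π_j[Z^{(j)}Z^{(j)}(u_{k+1})]`, then the 21 terms of `exp[…]` in PRINTED ORDER with the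
printed `½`'s: `quadA`, `quadF`, `Q1`–`Q3`, `fw3A`, `fw4f`, `Q4`–`Q6`, `quadPhi`, `quadPsi`, `phiW6Psi`, `psiW7Psi`, `calE`, `Ek`, `Pkloc`, `Rk`, `W1`, `Qk`, `W2`);
`bracket596 D = chars · holes · obs · zf · exp(exponent596 D)`.  HONEST SCOPE: the bracket identities `h54`, `h59` and the δ-claims `hs`, `hsupp`, `hQS` are HYPOTHESES here (E-level content of the rows
named above; p31's `BIJ88Eq552CutoffWitness` locates an imprecision in the printed position of `Λ₄^{(k)*}` relevant to `hQS`); nothing of §§5.10–5.15;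
no bound; the existence of `ρ₂` is this seat's `BIJ88Eq596Exists.isDT_rdt_axial` (hypothesis `h₂` here).  Imports this seat's `BIJ88Eq596Passage`,
`BIJ88RT54ScalarSubst`, `BIJ88RT552Transl` (Literature + Mathlib only).
-/

namespace Literature.MathematicalPhysics.QuantumFieldTheory.BalabanImbrieJaffe1984to88.BIJ88Eq596Frame

open Literature.MathematicalPhysics.QuantumFieldTheory.Balaban1983to89
open BIJ88Sect3Statements (U1)
open BIJ85Sect1Model (HiggsField)
open BIJ85RT33 (twist twist_apply)
open BIJ88RenormTransf311 (axialMeasure axialBonds gaussWeight)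
open BIJ88InductiveForm41 (Prev prevMeasure)
open BIJ85BlockAveragesTorus (qU surfMul absolutelyContinuous_map_qU)
open BIJ88Eq536Linearization (cutoff)
open BIJ88Eq531TranslLaw (axialMeasure_map_surfMul)
open BIJ88RT52Restrictions (Fields fieldsMeasure IsRD)
open BIJ88BlockGauge417 (twist_inv_twist)
open BIJ88Eq596Display (uCut vCut IsDT isDT_unique)
open BIJ88Eq596Passage (isDT_of_isRD)
open BIJ88RT54ScalarSubst (isDT_rotatePhi isDT_translatePhi integral_eq_of_rename integral_eq_of_rename_one)
open BIJ88RT552Transl (bondMul isDT_bondShift_axial)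
open scoped BigOperators ENNReal
open _root_.MeasureTheory _root_.MeasureTheory.Measure Complex Function

noncomputable section

variable {P : Params} {k : ℕ}

section Frame

variable {ι : Type*} {terms : Finset ι} {Λ : ι → Finset (PBond P (k+1))}
variable {Qφ : ι → Prev P k → GaugeField P k U1 → HiggsField P k → HiggsField P (k+1)} {a : ℝ}
variable {ρ : ι → Prev P k → GaugeField P k U1 → HiggsField P k → HiggsField P (k+1) → ℂ}
variable {ρL ρ₂ : GaugeField P (k+1) U1 → HiggsField P (k+1) → ℂ}
variable {J₂ J596 : ι → Prev P k → GaugeField P k U1 → GaugeField P (k+1) U1 → HiggsField P k → HiggsField P (k+1) → ℂ}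

/-- kernel: `λ(λ⁻¹φ) = φ` for the site rotations (r18's `twist_inv_twist`). [cite: BalabanImbrieJaffe1988, (5.4.5) p.282] -/
private theorem twist_twist_inv' {j : ℕ} (g : GaugeTransf P j U1) (φ : HiggsField P j) : twist g (twist (fun x => (g x)⁻¹) φ) = φ := by
  simpa only [inv_inv] using twist_inv_twist (fun x => (g x)⁻¹) φ

/-- **STEP (5.3.6): (5.2.8) ⇒ LINE 1 OF (5.9.6) with the bracket `ρ_t·gaussWeight` read in the translated variables** — *"The first translation is
done in Λ₁^{(k)*}, and it removes the v-field from the δ-functions there"* (this seat's `BIJ88Eq596Passage.isDT_of_isRD` over `𝒟u δ_{Ax}`; standing range).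
[cite: BalabanImbrieJaffe1988, (5.3.6) p.280] -/
theorem isDT_after536 (hk : k + 1 ≤ P.m + P.K) (h528 : IsRD (axialMeasure P k U1) terms qU Qφ a ρ ρL)
    (hρi : ∀ t ∈ terms, Integrable
      (fun q : Fields P k => ρ t q.2.1 q.1 q.2.2.1 q.2.2.2 * (gaussWeight a (Qφ t q.2.1 q.1 q.2.2.1) q.2.2.2 : ℂ))
      (fieldsMeasure (axialMeasure P k U1)))
    (Λ : ι → Finset (PBond P (k+1))) :
    IsDT (axialMeasure P k U1) terms Λ qU (fun t prev u' v φ ψ => ρ t prev (surfMul u' (cutoff (Λ t) v)) φ ψ *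
      (gaussWeight a (Qφ t prev (surfMul u' (cutoff (Λ t) v)) φ) ψ : ℂ)) ρL :=
  isDT_of_isRD hk axialMeasure_map_surfMul h528 hρi Λ

/-- **STEP p. 282, the rotation of `φ`**: if after (5.3.6) the bracket is a function of the rotated scalar fields, `ρ_t·gaussWeight (at u′·Q^{s*}(cutoff v),
φ, ψ) = J₂_t(…, λφ, λ′ψ)` (the background gauge transformation (5.4.5)–(5.4.6) with the phases of p. 282 — HYPOTHESIS `h54`), then the SAME density
satisfies line 1 of (5.9.6) with the bracket `J₂_t(…, φ, λ′ψ)`: *"The measure dφ is rotationally invariant, so we can replace dφ with dφ′ and drop the prime"*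
(`isDT_rotatePhi` by `λ⁻¹`). [cite: BalabanImbrieJaffe1988, (5.4.6) p.282] -/
theorem isDT_after_rotation (hk : k + 1 ≤ P.m + P.K) (h528 : IsRD (axialMeasure P k U1) terms qU Qφ a ρ ρL)
    (hρi : ∀ t ∈ terms, Integrable
      (fun q : Fields P k => ρ t q.2.1 q.1 q.2.2.1 q.2.2.2 * (gaussWeight a (Qφ t q.2.1 q.1 q.2.2.1) q.2.2.2 : ℂ))
      (fieldsMeasure (axialMeasure P k U1)))
    (Λ : ι → Finset (PBond P (k+1)))
    (lamφ : ι → Prev P k → GaugeField P k U1 → GaugeField P (k+1) U1 → GaugeTransf P k U1)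
    (lamψ : ι → Prev P k → GaugeField P k U1 → GaugeField P (k+1) U1 → GaugeTransf P (k+1) U1)
    (J₂ : ι → Prev P k → GaugeField P k U1 → GaugeField P (k+1) U1 → HiggsField P k → HiggsField P (k+1) → ℂ)
    (h54 : ∀ t ∈ terms, ∀ prev u' v φ ψ,
      ρ t prev (surfMul u' (cutoff (Λ t) v)) φ ψ * (gaussWeight a (Qφ t prev (surfMul u' (cutoff (Λ t) v)) φ) ψ : ℂ) =
        J₂ t prev u' v (twist (lamφ t prev u' v) φ) (twist (lamψ t prev u' v) ψ)) :
    IsDT (axialMeasure P k U1) terms Λ qU (fun t prev u' v φ ψ => J₂ t prev u' v φ (twist (lamψ t prev u' v) ψ)) ρL := by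
  have h1 := isDT_rotatePhi (fun t prev u' v _ => fun x => (lamφ t prev u' v x)⁻¹) (isDT_after536 hk h528 hρi Λ)
  refine h1.congr' fun t ht prev u' v φ ψ => ?_
  rw [h54 t ht, twist_twist_inv']

/-- **p. 282: *"However, the new density ρ^L_{k+1}(v, ψ) still has the property that ∫dvdψ ρ^L_{k+1}(v, ψ) = [F]"*** — `∫dvdψ ρ^L_{k+1} = ∫dvdψ ρ̃^L_{k+1}`,
the right side being `[F]` for the (4.1) data (gens 5–8). [cite: BalabanImbrieJaffe1988, (5.4.6) p.282] -/
theorem integral_renamed_eq (hk : k + 1 ≤ P.m + P.K) (h528 : IsRD (axialMeasure P k U1) terms qU Qφ a ρ ρL)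
    (hρi : ∀ t ∈ terms, Integrable
      (fun q : Fields P k => ρ t q.2.1 q.1 q.2.2.1 q.2.2.2 * (gaussWeight a (Qφ t q.2.1 q.1 q.2.2.1) q.2.2.2 : ℂ))
      (fieldsMeasure (axialMeasure P k U1)))
    (lamφ : ι → Prev P k → GaugeField P k U1 → GaugeField P (k+1) U1 → GaugeTransf P k U1)
    (lamψ : ι → Prev P k → GaugeField P k U1 → GaugeField P (k+1) U1 → GaugeTransf P (k+1) U1)
    (h54 : ∀ t ∈ terms, ∀ prev u' v φ ψ,
      ρ t prev (surfMul u' (cutoff (Λ t) v)) φ ψ * (gaussWeight a (Qφ t prev (surfMul u' (cutoff (Λ t) v)) φ) ψ : ℂ) =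
        J₂ t prev u' v (twist (lamφ t prev u' v) φ) (twist (lamψ t prev u' v) ψ))
    (h₂ : IsDT (axialMeasure P k U1) terms Λ qU J₂ ρ₂) :
    ∫ v, ∫ ψ, ρ₂ v ψ ∂volume ∂fieldMeasure P (k+1) U1 = ∫ v, ∫ ψ, ρL v ψ ∂volume ∂fieldMeasure P (k+1) U1 :=
  integral_eq_of_rename_one lamψ (fun _ _ _ _ _ _ _ => rfl) (isDT_after_rotation hk h528 hρi Λ lamφ lamψ J₂ h54) h₂

/-- **More: `ρ^L_{k+1}` and `ρ̃^L_{k+1}` integrate every ψ-rotation-invariant bounded measurable test function equally** (all gauge-invariant observables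
of the block fields). [cite: BalabanImbrieJaffe1988, (5.4.6) p.282] -/
theorem integral_renamed_eq_of_invariant (hk : k + 1 ≤ P.m + P.K) (h528 : IsRD (axialMeasure P k U1) terms qU Qφ a ρ ρL)
    (hρi : ∀ t ∈ terms, Integrable
      (fun q : Fields P k => ρ t q.2.1 q.1 q.2.2.1 q.2.2.2 * (gaussWeight a (Qφ t q.2.1 q.1 q.2.2.1) q.2.2.2 : ℂ))
      (fieldsMeasure (axialMeasure P k U1)))
    (lamφ : ι → Prev P k → GaugeField P k U1 → GaugeField P (k+1) U1 → GaugeTransf P k U1)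
    (lamψ : ι → Prev P k → GaugeField P k U1 → GaugeField P (k+1) U1 → GaugeTransf P (k+1) U1)
    (h54 : ∀ t ∈ terms, ∀ prev u' v φ ψ,
      ρ t prev (surfMul u' (cutoff (Λ t) v)) φ ψ * (gaussWeight a (Qφ t prev (surfMul u' (cutoff (Λ t) v)) φ) ψ : ℂ) =
        J₂ t prev u' v (twist (lamφ t prev u' v) φ) (twist (lamψ t prev u' v) ψ))
    (h₂ : IsDT (axialMeasure P k U1) terms Λ qU J₂ ρ₂)
    {g : GaugeField P (k+1) U1 × HiggsField P (k+1) → ℂ} (hg : Measurable g) (hb : ∃ C : ℝ, ∀ z, ‖g z‖ ≤ C)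
    (hginv : ∀ (μ : GaugeTransf P (k+1) U1) v ψ, g (v, twist μ ψ) = g (v, ψ)) :
    ∫ v, ∫ ψ, ρ₂ v ψ * g (v, ψ) ∂volume ∂fieldMeasure P (k+1) U1 =
      ∫ v, ∫ ψ, ρL v ψ * g (v, ψ) ∂volume ∂fieldMeasure P (k+1) U1 :=
  integral_eq_of_rename lamψ (fun _ _ _ _ _ _ _ => rfl) (isDT_after_rotation hk h528 hρi Λ lamφ lamψ J₂ h54) h₂ hg hb hginv

/-- **(5.9.6) AT MEASURE LEVEL — THE COMPOSITION.**  Data and hypotheses (each a printed step; verbatim texts in the docstrings of the files that prove them):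
`h528` the display (5.2.8) over `∫𝒟u δ_{Ax}` with the printed `Q` and integrable term integrands (gen 8's `density528`); `Λ_t = Λ₁^{(k)′*}`; `h54`: after
(5.3.6) the bracket is `J₂` at the rotated scalar fields ((5.4.5)–(5.4.6), p. 282); `h₂`: `ρ₂` is a renamed density — a solution of line 1 of
(5.9.6) with the bracket `J₂` (*"a different density is obtained by replacing ψ′ with ψ"*; it exists: `BIJ88Eq596Exists.isDT_rdt_axial`); (5.5.2) with the p. 284 δ-claims: shifts `s_t(v|_Λ)` trivial on the axial tree bonds (`hs`: *"δ_{Ax}(A′) = δ_{Ax}(A^{(k)})"*), small-field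
sets `S_t` supporting `J₂` (`hsupp`) on which the block averages are unchanged by the shifts and their inverses (`hQS`: *"δ(QA′) = δ(QA^{(k)})"*); the
(5.8.1) shifts `c_t`; `h59`: the printed bracket `J596` of (5.9.6) IS the renamed bracket read in the shifted gauge variable `u^{(k)}·s_t` and the
translated scalar variable `φ^{(k)} + c_t` — the concluding formulae (5.5.3)–(5.5.14), (5.6.6)–(5.6.13), (5.7.13), (5.8.2)–(5.8.3) and the
insertions of Sect. 5.9, all pointwise.  CONCLUSION: the renamed density `ρ^L_{k+1} = ρ₂` SATISFIES LINE 1 OF (5.9.6) WITH THE PRINTED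
BRACKET, `IsDT (𝒟u δ_{Ax}) terms Λ Q J596 ρ^L_{k+1}`, and `∫dvdψ ρ^L_{k+1} = ∫dvdψ ρ̃^L_{k+1}` (standing range). [cite: BalabanImbrieJaffe1988, (5.9.6) p.297] -/
theorem eq596_frame (hk : k + 1 ≤ P.m + P.K) (h528 : IsRD (axialMeasure P k U1) terms qU Qφ a ρ ρL)
    (hρi : ∀ t ∈ terms, Integrable
      (fun q : Fields P k => ρ t q.2.1 q.1 q.2.2.1 q.2.2.2 * (gaussWeight a (Qφ t q.2.1 q.1 q.2.2.1) q.2.2.2 : ℂ))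
      (fieldsMeasure (axialMeasure P k U1)))
    (Λ : ι → Finset (PBond P (k+1)))
    (lamφ : ι → Prev P k → GaugeField P k U1 → GaugeField P (k+1) U1 → GaugeTransf P k U1)
    (lamψ : ι → Prev P k → GaugeField P k U1 → GaugeField P (k+1) U1 → GaugeTransf P (k+1) U1)
    (J₂ : ι → Prev P k → GaugeField P k U1 → GaugeField P (k+1) U1 → HiggsField P k → HiggsField P (k+1) → ℂ)
    (h54 : ∀ t ∈ terms, ∀ prev u' v φ ψ,
      ρ t prev (surfMul u' (cutoff (Λ t) v)) φ ψ * (gaussWeight a (Qφ t prev (surfMul u' (cutoff (Λ t) v)) φ) ψ : ℂ) =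
        J₂ t prev u' v (twist (lamφ t prev u' v) φ) (twist (lamψ t prev u' v) ψ))
    (h₂ : IsDT (axialMeasure P k U1) terms Λ qU J₂ ρ₂)
    (s : ι → GaugeField P (k+1) U1 → GaugeField P k U1) (hs : ∀ t ∈ terms, ∀ w, ∀ b ∈ (axialBonds : Finset (PBond P k)), s t w b = 1)
    (S : ι → Set (GaugeField P k U1)) (hsupp : ∀ t ∈ terms, ∀ prev u' v φ ψ, J₂ t prev u' v φ ψ ≠ 0 → u' ∈ S t)
    (hQS : ∀ t ∈ terms, ∀ u' ∈ S t, ∀ w, qU (bondMul u' (s t w)) = qU u' ∧ qU (bondMul u' fun b => (s t w b)⁻¹) = qU u')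
    (c : ι → Prev P k → GaugeField P k U1 → GaugeField P (k+1) U1 → HiggsField P (k+1) → HiggsField P k)
    (J596 : ι → Prev P k → GaugeField P k U1 → GaugeField P (k+1) U1 → HiggsField P k → HiggsField P (k+1) → ℂ)
    (h59 : ∀ t ∈ terms, ∀ prev u' v φ ψ,
      J596 t prev u' v φ ψ = J₂ t prev (bondMul u' (s t (cutoff (Λ t) v))) v (φ + c t prev u' v ψ) ψ) :
    IsDT (axialMeasure P k U1) terms Λ qU J596 ρ₂ ∧
      ∫ v, ∫ ψ, ρ₂ v ψ ∂volume ∂fieldMeasure P (k+1) U1 = ∫ v, ∫ ψ, ρL v ψ ∂volume ∂fieldMeasure P (k+1) U1 := by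
  refine ⟨?_, integral_renamed_eq hk h528 hρi lamφ lamψ h54 h₂⟩
  -- (5.5.2), then (5.8.1), on the renamed density; then the pointwise rewriting into the printed bracket
  have h4 := isDT_bondShift_axial hk s hs S hsupp hQS h₂
  have h5 := isDT_translatePhi c h4
  exact h5.congr' fun t ht prev u' v φ ψ => h59 t ht prev u' v φ ψ

/-- **(5.9.6) determines `ρ^L_{k+1}`**: every `dv dψ`-integrable density satisfying line 1 of (5.9.6) with the printed bracket (under the hypotheses of
`eq596_frame`) equals the renamed density `ρ₂` almost everywhere. [cite: BalabanImbrieJaffe1988, (5.9.6) p.297] -/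
theorem eq596_unique (hk : k + 1 ≤ P.m + P.K) (h528 : IsRD (axialMeasure P k U1) terms qU Qφ a ρ ρL)
    (hρi : ∀ t ∈ terms, Integrable
      (fun q : Fields P k => ρ t q.2.1 q.1 q.2.2.1 q.2.2.2 * (gaussWeight a (Qφ t q.2.1 q.1 q.2.2.1) q.2.2.2 : ℂ))
      (fieldsMeasure (axialMeasure P k U1)))
    (Λ : ι → Finset (PBond P (k+1)))
    (lamφ : ι → Prev P k → GaugeField P k U1 → GaugeField P (k+1) U1 → GaugeTransf P k U1)
    (lamψ : ι → Prev P k → GaugeField P k U1 → GaugeField P (k+1) U1 → GaugeTransf P (k+1) U1)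
    (J₂ : ι → Prev P k → GaugeField P k U1 → GaugeField P (k+1) U1 → HiggsField P k → HiggsField P (k+1) → ℂ)
    (h54 : ∀ t ∈ terms, ∀ prev u' v φ ψ,
      ρ t prev (surfMul u' (cutoff (Λ t) v)) φ ψ * (gaussWeight a (Qφ t prev (surfMul u' (cutoff (Λ t) v)) φ) ψ : ℂ) =
        J₂ t prev u' v (twist (lamφ t prev u' v) φ) (twist (lamψ t prev u' v) ψ))
    (h₂ : IsDT (axialMeasure P k U1) terms Λ qU J₂ ρ₂) (hi₂ : Integrable (uncurry ρ₂) ((fieldMeasure P (k+1) U1).prod volume))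
    (s : ι → GaugeField P (k+1) U1 → GaugeField P k U1) (hs : ∀ t ∈ terms, ∀ w, ∀ b ∈ (axialBonds : Finset (PBond P k)), s t w b = 1)
    (S : ι → Set (GaugeField P k U1)) (hsupp : ∀ t ∈ terms, ∀ prev u' v φ ψ, J₂ t prev u' v φ ψ ≠ 0 → u' ∈ S t)
    (hQS : ∀ t ∈ terms, ∀ u' ∈ S t, ∀ w, qU (bondMul u' (s t w)) = qU u' ∧ qU (bondMul u' fun b => (s t w b)⁻¹) = qU u')
    (c : ι → Prev P k → GaugeField P k U1 → GaugeField P (k+1) U1 → HiggsField P (k+1) → HiggsField P k)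
    (J596 : ι → Prev P k → GaugeField P k U1 → GaugeField P (k+1) U1 → HiggsField P k → HiggsField P (k+1) → ℂ)
    (h59 : ∀ t ∈ terms, ∀ prev u' v φ ψ,
      J596 t prev u' v φ ψ = J₂ t prev (bondMul u' (s t (cutoff (Λ t) v))) v (φ + c t prev u' v ψ) ψ)
    {ρ' : GaugeField P (k+1) U1 → HiggsField P (k+1) → ℂ} (hi' : Integrable (uncurry ρ') ((fieldMeasure P (k+1) U1).prod volume))
    (h' : IsDT (axialMeasure P k U1) terms Λ qU J596 ρ') :
    uncurry ρ' =ᵐ[(fieldMeasure P (k+1) U1).prod volume] uncurry ρ₂ :=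
  isDT_unique h' (eq596_frame hk h528 hρi Λ lamφ lamψ J₂ h54 h₂ s hs S hsupp hQS c J596 h59).1 hi' hi₂

end Frame

/-! ## §2 The printed bracket of (5.9.6), transcribed -/

section Printed

variable {ι : Type*}

/-- The type of the entries of the bracket of (5.9.6): functions of the term `t = ({X_ω}, Λ₀^{(k)})` and of the variables the display integrates or
depends on — `{u^{(j)}}_{j<k}`, the translated gauge field `u^{(k)}`, the block gauge field `v` (through `f`, `u_{k+1}`, `ũ_{k+1}`), `φ^{(k)}`, `ψ`.
[cite: BalabanImbrieJaffe1988, (5.9.6) p.297] -/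
abbrev Entry (P : Params) (k : ℕ) (ι : Type*) (α : Type) : Type _ :=
  ι → Prev P k → GaugeField P k U1 → GaugeField P (k+1) U1 → HiggsField P k → HiggsField P (k+1) → α

/-- **THE ENTRIES OF THE BRACKET OF (5.9.6), LINES 2–8, AS TYPED SLOTS** (a transcription of the printed display: each printed symbol is one
field, read as a function of the term and of `({u^{(j)}}, u^{(k)}, v, φ^{(k)}, ψ)`; their constructions are the rows C2.Eq5.2.x–5.8.x of the skeleton
and are NOT repeated here). [cite: BalabanImbrieJaffe1988, (5.9.6) p.297] -/
structure Bracket596 (P : Params) (k : ℕ) (ι : Type*) where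
  /-- `ζ_{Λ₀^{(k)c}} χ_{Λ₀^{(k)}} χ_{k,Λ₀^{(k−1)′}∩Λ₁^{(k)c}} χ_{k+1,Λ₀^{(k)′}} χ′_{Λ₇^{(k)}}` — the characteristic functions ((5.2.7), (5.2.2), p. 297). -/
  chars : Entry P k ι ℝ
  /-- `Π_ω g_k(X_ω)` — the large-field ("hole") functionals of (4.1). -/
  holes : Entry P k ι ℂ
  /-- `Π_σ (F^{(m̄)}_{k,loc}(X_σ) + F̃^{(k)}_{loc}(X_σ))` — the observable factors (§5.10 split of `F_{k,loc}`). -/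
  obs : Entry P k ι ℂ
  /-- `Π_{j=0}^{k−1} [Z^{(j)}_{Λ₁₀^{(j)c*c}} Z^{(j)}_{Λ₁₀^{(j)}}(u_{k+1})]` — the Gaussian normalization factors ((4.9), (5.7.13)). -/
  zf : Entry P k ι ℝ
  /-- `⟨Λ₁^{(k)**}∂A^{(k)}, σ_{k,loc}Λ₁^{(k)**}∂A^{(k)}⟩` ((5.5.3)). -/
  quadA : Entry P k ι ℝ
  /-- `⟨Λ₅^{(k)′**}f, σ^L_{k+1,loc}Λ₅^{(k)′**}f⟩` ((5.5.10)–(5.5.12)). -/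
  quadF : Entry P k ι ℝ
  /-- `𝒬₁` ((5.3.5)). -/
  Q1 : Entry P k ι ℝ
  /-- `𝒬₂` ((5.5.9)). -/
  Q2 : Entry P k ι ℝ
  /-- `𝒬₃` ((5.5.12)). -/
  Q3 : Entry P k ι ℝ
  /-- `⟨f, w₃A^{(k)}⟩` ((5.5.8)). -/
  fw3A : Entry P k ι ℝ
  /-- `⟨f, w₄f⟩` ((5.5.12)). -/
  fw4f : Entry P k ι ℝ
  /-- `𝒬₄` ((5.8.2)). -/
  Q4 : Entry P k ι ℝ
  /-- `𝒬₅` ((5.8.3)). -/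
  Q5 : Entry P k ι ℝ
  /-- `𝒬₆` ((5.8.3)). -/
  Q6 : Entry P k ι ℝ
  /-- `⟨Λ₈^{(k−1)′}φ^{(k)}, (Δ_{k,loc}(ũ_{k+1}) + aL⁻²P(ũ_{k+1}))Λ₈^{(k−1)′}φ^{(k)}⟩` ((5.8.2)). -/
  quadPhi : Entry P k ι ℝ
  /-- `⟨Λ₈^{(k)′}ψ, Δ^L_{k+1,loc}(u_{k+1})Λ₈^{(k)′}ψ⟩` ((5.8.3)). -/
  quadPsi : Entry P k ι ℝ
  /-- `⟨φ^{(k)}, w₆ψ⟩` ((5.8.3)). -/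
  phiW6Psi : Entry P k ι ℝ
  /-- `⟨ψ, w₇ψ⟩` ((5.8.3)). -/
  psiW7Psi : Entry P k ι ℝ
  /-- `ℰ_k` (the constant of (4.1)/(3.10)). -/
  calE : Entry P k ι ℝ
  /-- `E^{(k)}` ((5.1.2)). -/
  Ek : Entry P k ι ℝ
  /-- `𝒫_{k,loc}(Λ₈^{(k−1)}, ũ_{k+1})` ((5.2.5), (5.6.13)). -/
  Pkloc : Entry P k ι ℝ
  /-- `R^{(k)}(u_{k+1}, θ_kH_{k,loc}A^{(k)})` ((5.6.14)). -/
  Rk : Entry P k ι ℝ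
  /-- `Σ_□ W₁^{(k)}(□)` ((5.6.13)). -/
  W1 : Entry P k ι ℝ
  /-- `Q^{(k)}(u_{k+1}, θ_kH_{k,loc}A^{(k)})` ((5.7.13)). -/
  Qk : Entry P k ι ℝ
  /-- `Σ_X W₂^{(k)}(X)` ((5.7.13)). -/
  W2 : Entry P k ι ℝ

variable (D : Bracket596 P k ι)

/-- **THE EXPONENT OF (5.9.6), lines 3–8** — *"exp[−½⟨Λ₁^{(k)**}∂A^{(k)}, σ_{k,loc}Λ₁^{(k)**}∂A^{(k)}⟩ − ½⟨Λ₅^{(k)′**}f, σ^L_{k+1,loc}Λ₅^{(k)′**}f⟩ − 𝒬₁ − 𝒬₂ − 𝒬₃ −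
⟨f, w₃A^{(k)}⟩ − ½⟨f, w₄f⟩ − 𝒬₄ − 𝒬₅ − 𝒬₆ − ½⟨Λ₈^{(k−1)′}φ^{(k)}, (Δ_{k,loc}(ũ_{k+1}) + aL⁻²P(ũ_{k+1}))Λ₈^{(k−1)′}φ^{(k)}⟩ − ½⟨Λ₈^{(k)′}ψ, Δ^L_{k+1,loc}(u_{k+1})Λ₈^{(k)′}ψ⟩
− ⟨φ^{(k)}, w₆ψ⟩ − ½⟨ψ, w₇ψ⟩ − ℰ_k − E^{(k)} − 𝒫_{k,loc}(Λ₈^{(k−1)}, ũ_{k+1}) − R^{(k)}(…) − Σ_□W₁^{(k)}(□) − Q^{(k)}(…) − Σ_XW₂^{(k)}(X)]"* (transcribed).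
[cite: BalabanImbrieJaffe1988, (5.9.6) p.297] -/
def exponent596 : Entry P k ι ℝ := fun t prev u v φ ψ =>
  -(D.quadA t prev u v φ ψ / 2 + D.quadF t prev u v φ ψ / 2 + D.Q1 t prev u v φ ψ + D.Q2 t prev u v φ ψ + D.Q3 t prev u v φ ψ
    + D.fw3A t prev u v φ ψ + D.fw4f t prev u v φ ψ / 2 + D.Q4 t prev u v φ ψ + D.Q5 t prev u v φ ψ + D.Q6 t prev u v φ ψ
    + D.quadPhi t prev u v φ ψ / 2 + D.quadPsi t prev u v φ ψ / 2 + D.phiW6Psi t prev u v φ ψ + D.psiW7Psi t prev u v φ ψ / 2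
    + D.calE t prev u v φ ψ + D.Ek t prev u v φ ψ + D.Pkloc t prev u v φ ψ + D.Rk t prev u v φ ψ + D.W1 t prev u v φ ψ
    + D.Qk t prev u v φ ψ + D.W2 t prev u v φ ψ)

/-- **THE BRACKET OF (5.9.6), lines 2–8, transcribed**: `ζχχχχ′ · Πg_k(X_ω) · Π(F^{(m̄)} + F̃) · Π[ZZ(u_{k+1})] · exp[…]`.
[cite: BalabanImbrieJaffe1988, (5.9.6) p.297] -/
def bracket596 : Entry P k ι ℂ := fun t prev u v φ ψ =>
  (D.chars t prev u v φ ψ : ℂ) * D.holes t prev u v φ ψ * D.obs t prev u v φ ψ * (D.zf t prev u v φ ψ : ℂ) *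
    (Real.exp (exponent596 D t prev u v φ ψ) : ℂ)

variable {terms : Finset ι}
variable {Qφ : ι → Prev P k → GaugeField P k U1 → HiggsField P k → HiggsField P (k+1)} {a : ℝ}
variable {ρ : ι → Prev P k → GaugeField P k U1 → HiggsField P k → HiggsField P (k+1) → ℂ}
variable {ρL : GaugeField P (k+1) U1 → HiggsField P (k+1) → ℂ}

/-- **(5.9.6) WITH THE TRANSCRIBED BRACKET** — `eq596_frame` with `J596 := bracket596 D`: if the concluding formulae of Sects. 5.4–5.9 identify the
renamed bracket, read in the shifted gauge variable and the translated scalar variable, with the printed product `ζχχχχ′·Πg·Π(F+F̃)·ΠZZ·exp[…]`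
(hypothesis `h59`, pointwise), then the renamed density `ρ₂` satisfies LINE 1 OF (5.9.6) WITH LINES 2–8 AS THE BRACKET and has the total
integral of `ρ̃^L_{k+1}`. [cite: BalabanImbrieJaffe1988, (5.9.6) p.297] -/
theorem eq596_frame_printed (hk : k + 1 ≤ P.m + P.K) (h528 : IsRD (axialMeasure P k U1) terms qU Qφ a ρ ρL)
    (hρi : ∀ t ∈ terms, Integrable
      (fun q : Fields P k => ρ t q.2.1 q.1 q.2.2.1 q.2.2.2 * (gaussWeight a (Qφ t q.2.1 q.1 q.2.2.1) q.2.2.2 : ℂ))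
      (fieldsMeasure (axialMeasure P k U1)))
    (Λ : ι → Finset (PBond P (k+1)))
    (lamφ : ι → Prev P k → GaugeField P k U1 → GaugeField P (k+1) U1 → GaugeTransf P k U1)
    (lamψ : ι → Prev P k → GaugeField P k U1 → GaugeField P (k+1) U1 → GaugeTransf P (k+1) U1)
    (J₂ : Entry P k ι ℂ)
    (h54 : ∀ t ∈ terms, ∀ prev u' v φ ψ,
      ρ t prev (surfMul u' (cutoff (Λ t) v)) φ ψ * (gaussWeight a (Qφ t prev (surfMul u' (cutoff (Λ t) v)) φ) ψ : ℂ) =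
        J₂ t prev u' v (twist (lamφ t prev u' v) φ) (twist (lamψ t prev u' v) ψ))
    {ρ₂ : GaugeField P (k+1) U1 → HiggsField P (k+1) → ℂ} (h₂ : IsDT (axialMeasure P k U1) terms Λ qU J₂ ρ₂)
    (s : ι → GaugeField P (k+1) U1 → GaugeField P k U1) (hs : ∀ t ∈ terms, ∀ w, ∀ b ∈ (axialBonds : Finset (PBond P k)), s t w b = 1)
    (S : ι → Set (GaugeField P k U1)) (hsupp : ∀ t ∈ terms, ∀ prev u' v φ ψ, J₂ t prev u' v φ ψ ≠ 0 → u' ∈ S t)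
    (hQS : ∀ t ∈ terms, ∀ u' ∈ S t, ∀ w, qU (bondMul u' (s t w)) = qU u' ∧ qU (bondMul u' fun b => (s t w b)⁻¹) = qU u')
    (c : ι → Prev P k → GaugeField P k U1 → GaugeField P (k+1) U1 → HiggsField P (k+1) → HiggsField P k)
    (h59 : ∀ t ∈ terms, ∀ prev u' v φ ψ,
      bracket596 D t prev u' v φ ψ = J₂ t prev (bondMul u' (s t (cutoff (Λ t) v))) v (φ + c t prev u' v ψ) ψ) :
    IsDT (axialMeasure P k U1) terms Λ qU (bracket596 D) ρ₂ ∧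
      ∫ v, ∫ ψ, ρ₂ v ψ ∂volume ∂fieldMeasure P (k+1) U1 = ∫ v, ∫ ψ, ρL v ψ ∂volume ∂fieldMeasure P (k+1) U1 :=
  eq596_frame hk h528 hρi Λ lamφ lamψ J₂ h54 h₂ s hs S hsupp hQS c (bracket596 D) h59

end Printed

end

end Literature.MathematicalPhysics.QuantumFieldTheory.BalabanImbrieJaffe1984to88.BIJ88Eq596Frame
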